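import Literature.NumberTheory.Automorphic.RankinSelbergContinuationGlue
import Literature.NumberTheory.Automorphic.SatakeParameterUnitBound
import Literature.NumberTheory.Automorphic.PairLFunctionBaseChangeAutomorphic
import Literature.NumberTheory.Automorphic.SummableNormSqTraceSatakePow
import Literature.NumberTheory.Automorphic.JacquetShalikaSchurSelfSum
import HarnessLib

/-!
# Jacquet–Shalika's Thm. (5.3) for pairs (`JacquetShalika1981_multipliable_partialPairL`):
proof file — the far-right half-plane, the one-family form of Lemma (5.2), partial discharges

Topic `NumberTheory/Automorphic`; namespace `Literature.Automorphic`. Sibling proof file of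
`PairLFunctionBaseChange`, whose named fact `JacquetShalika1981_multipliable_partialPairL`
(Jacquet–Shalika, *On Euler products and the classification of automorphic representations I*,
Amer. J. Math. **103** (1981), Thm. (5.3), quoted as (2.1) in Arthur–Clozel (1989), Ch. 3, §2: for
unitary cuspidal `π` on `GL_n(𝔸_K)`, `σ` on `GL_m(𝔸_K)` with Satake families `α`, `β` off `S`, the
partial Euler product `L^S(s, π ⊗ σ) = ∏_{v ∉ S} det(1 - t_{π,v} ⊗ t_{σ,v} q_v^{-s})⁻¹` is multipliable
on `re s > 1`) is the object of this file.

## Status of the fact in the tree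

The printed proof (loc. cit. pp. 555–557) is formalised in `JacquetShalikaEulerProducts`,
`SatakeParameterTrivialBound`, `JacquetShalikaPairsFromLemma52`, `UnramifiedHeckeScalarsFlathProofs`
and `AutomorphicLFunctionFlathProofs`: by
`JacquetShalika1981_multipliable_partialPairL_of_continuation_partialPairL` the fact follows from
the **single** remaining named input `JacquetShalika1981_continuation_partialPairL_conj` — loc. cit.
**Lemma (5.2)**, the analytic continuation of `L_S(s, π × π̄)` to `re s > 1` — at `GL_n` and at
`GL_m`; the local bound (5.1.3) and Flath's theorem, the other two inputs of the printed proof, are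
theorems of the tree. Lemma (5.2) is the global Rankin–Selberg theory of loc. cit. §4 (mirabolic
Eisenstein series, Whittaker–Fourier expansion of cusp forms on `GL_n`, unfolding, the unramified
computation of §2 and the local non-vanishing of §§1, 3), none of which exists in Lean;
`RankinSelbergContinuationGlue` has already isolated its complex-analytic last step. Accordingly
`JacquetShalika1981_multipliable_partialPairL_holds` is **not** proved here. This file proves:

* `summable_norm_inv_eval_satakePairPolynomial_sub_one_of_rpow`,
  `multipliable_inv_eval_satakePairPolynomial_of_rpow`, `eval_satakePairPolynomial_ne_zero_of_rpow`
  (pure estimates): under polynomial bounds `|a| ≤ q_v^B`, `|b| ≤ q_v^{B'}` the pair Euler product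
  `∏_{v ∉ S} ∏_{a, b} (1 - a b q_v^{-s})⁻¹` converges absolutely, with non-vanishing factors, on
  `re s > B + B' + 1`;
* `absolutelyConvergent_partialPairL_of_lt_re`, `multipliable_partialPairL_of_lt_re`,
  `hasProd_partialPairL_of_lt_re` — **the statement of the fact on the half-plane
  `re s > n² + m² + 3`, unconditionally** (loc. cit. (5.1.4): "the infinite product converges
  absolutely in some right half-plane", made explicit by the proved trivial bound
  `IsSatakeFamilyOf.norm_le_rpow`, `|a| ≤ q_v^{n² + 1}`, in place of (5.1.3));
* `exists_continuation_partialPairL_conj_of_subset` and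
  `JacquetShalika1981_continuation_partialPairL_conj_of_one_family` — **the one-family form of
  Lemma (5.2)**: the tree's rendering of Lemma (5.2) quantifies, for each cuspidal `Π`, over *all*
  finite `S ⊇ S₀` and *all* Satake families `α` of `Π` off `S`; it already follows from a holomorphic
  continuation of `L_{S₀}(s, α₀ × ᾱ₀)` for **one** finite `S₀` and **one** Satake family `α₀` of `Π`
  off `S₀` — the shape in which the Rankin–Selberg method delivers it (one choice of `S` "large
  enough", (5.1), and of the data `W, W', Φ`). Proof: Satake families of `Π` agree off their
  exceptional sets (`IsSatakeFamilyOf.eq_of_not_mem`, uniqueness of Hecke–Satake parameters, proved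
  in the tree), and on the far-right half-plane of absolute convergence
  `L_{S₀} = (∏_{v ∈ S ∖ S₀} P_v(q_v^{-s})⁻¹) · L_S` with non-vanishing entire factors `P_v(q_v^{-s})`,
  so `F · ∏_{v ∈ S ∖ S₀} P_v(q_v^{-s})` continues `L_S`;
  `JacquetShalika1981_continuation_partialPairL_conj_of_local_quotients_one_family` combines this
  with the patching lemma of `RankinSelbergContinuationGlue` (local quotient representations
  `I = A · L_{S₀}`, `A(s₀) ≠ 0`, for one family);
* `JacquetShalika1981_multipliable_partialPairL_of_one_family` — the fact from one-family
  continuation data at `GL_n` and at `GL_m`;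
* `JacquetShalika1981_multipliable_partialPairL_of_le_one` — **the fact for `n, m ≤ 1`,
  unconditionally** (Hecke `L`-functions of pairs of unitary idele class characters:
  `continuation_partialPairL_conj_of_le_one` of `SatakeParameterUnitBound`), and
  `JacquetShalika1981_multipliable_partialPairL_of_ramanujan` — the fact under clause (i) of the
  Ramanujan conjecture `Literature.NumberTheory.Automorphic.RamanujanConjectureGL` at `n` and at `m` (a documented
  conditional; `continuation_partialPairL_conj_of_ramanujan`).

* `differentiableOn_exp_normSqTraceSeries_of_summable`, `continuation_partialPairL_conj_of_summable`
  — **(5.3.3) implies Lemma (5.2)** in the tree: if `∑_{v ∉ S} ∑_k |tr A_v^k|² / (k q_v^{kσ}) < ∞`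
  for every real `σ > 1` then `L_S(s, α × ᾱ) = exp (∑_N a_N N^{-s})` is holomorphic on `re s > 1`
  (abscissa of absolute convergence `≤ 1`), so the named fact `summable_normSq_trace_satakePow` of
  `AutomorphicLFunctionProofs` implies `JacquetShalika1981_continuation_partialPairL_conj`; with
  Landau's lemma in the other direction (`summable_normSq_trace_of_continuation_of_rpow`) the two
  named inputs of Thm. (5.3) are interchangeable;
* `summable_normSq_trace_satakePow_of_one_family`,
  `summable_normSq_trace_satakePow_of_sqrt_of_one_family` — **the one-family form of (5.3.3)**:
  the named fact `summable_normSq_trace_satakePow` (every `S`, every Satake family) follows from the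
  convergence of the series of **one** Satake family `α₀` off **one** finite set `S₀` of ramified
  places of `Π` (sub-series, uniqueness of Hecke–Satake parameters), or off any finite `S₀` given
  (5.1.3) at the unramified places inside `S₀` (the printed order: `S` large, Cor. (2.5)); the
  weaker reduction "all finite `S₀` suffice" is `summable_normSq_trace_satakePow_of_finset` of
  `SummableNormSqTraceSatakePow`;
* `JacquetShalika1981_multipliable_partialPairL_of_one_family_summable`,
  `JacquetShalika1981_multipliable_partialPairL_of_finset_summable`,
  `JacquetShalika1981_multipliable_partialPairL_of_one_family_summable_of_le_one` — the fact from
  one-family summability data at `GL_n` and at `GL_m` (resp. at `GL_n` alone when `m ≤ 1`).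

* `JacquetShalika1981_multipliable_partialPairL_of_largeFinset`,
  `JacquetShalika1981_multipliable_partialPairL_of_schurSelfSum_prod_bounded` (and `…_of_le_one`) —
  **the fact from (J)** (`summable_normSq_trace_largeFinset` of `JacquetShalikaLargeFinset`:
  (5.3.3)–(5.3.4) off large finite sets, the printed generality) **at `GL_n` and at `GL_m`**, and from
  the equivalent real-variable statement `JacquetShalika1981_schurSelfSum_prod_bounded` of
  `JacquetShalikaSchurSelfSum` (bounded finite partial products of the unramified Rankin–Selberg torus
  sums `∑_λ |s_λ(x_v)|² q_v^{-|λ|σ}` at real `σ > 1`) — the currency in which the real-point unfolding of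
  §4 of the source delivers its output; the Flath input is the discharged `exists_isSatakeFamilyOf_holds`.

Nothing here restates or weakens a named fact; no definition, instance or named fact is added.

## What remains for `JacquetShalika1981_multipliable_partialPairL_holds`

Exactly (J) at every rank — equivalently `JacquetShalika1981_schurSelfSum_prod_bounded` at every rank,
after which the discharge is the term
`JacquetShalika1981_multipliable_partialPairL_of_schurSelfSum_prod_bounded B B` — or a proof
`JacquetShalika1981_continuation_partialPairL_conj_holds` of Lemma (5.2) (at every rank), after which
the discharge is the term
`JacquetShalika1981_multipliable_partialPairL_of_continuation_partialPairL L52 L52`; by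
`JacquetShalika1981_continuation_partialPairL_conj_of_local_quotients_one_family` it suffices that
the global Rankin–Selberg theory produce, for each cuspidal `Π`, the quotient representation
`I = A · L_{S₀}(s, α₀ × ᾱ₀)` with `A(s₀) ≠ 0` for **one** finite `S₀` and **one** Satake family `α₀`.
**Equivalently** (`JacquetShalika1981_multipliable_partialPairL_of_one_family_summable`), it
suffices to bound, for each cuspidal `Π`, one finite set `S₀` of ramified places and one Satake
family `α₀` off `S₀`, the series of non-negative reals
`∑_{v ∉ S₀} ∑_{k ≥ 1} |tr α₀(v)^k|² / (k q_v^{kσ})` for every real `σ > 1` — the value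
`log L_{S₀}(σ, π × π̄)`, which the Rankin–Selberg unfolding controls at real points by positivity
(`|W_φ|² ≥ 0` and Tonelli, Bessel's inequality on `N(K)\N(𝔸)` in place of the full
Whittaker–Fourier expansion), with no analytic continuation, Landau lemma or local non-vanishing
at complex points; the local input is in both forms the unramified computation of §2
(`Ψ_v(σ, W°, W̄°, Φ°) = L(σ, π_v × π̄_v)`, Shintani's formula and the Cauchy identity).

## References

* H. Jacquet, J. A. Shalika, *On Euler products and the classification of automorphic
  representations I*, Amer. J. Math. 103 (1981), 499–558: (5.1), (5.1.4) and Lemma (5.2) p. 554,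
  proof p. 555; Thm. (5.3) p. 555, proof pp. 555–557. [JacquetShalikaAJM1981]
* J. Arthur, L. Clozel, *Simple algebras, base change, and the advanced theory of the trace
  formula*, Ann. of Math. Stud. 120 (1989), Ch. 3, §2, (2.1) (p. 171 of the held copy: "The Euler
  product `L^S` is absolutely convergent for `Re s > 1` (cf. [27(a), Thm. 5.3])").
  [ArthurClozelAMS120]
* J. W. Cogdell, *Analytic theory of `L`-functions for `GL_n`*, in *An Introduction to the
  Langlands Program* (Birkhäuser, 2003), §4.1–§4.2 (continuation of `L(s, π × π')` from the global
  integrals for one choice of `S` and of the local data).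
-/

noncomputable section

open scoped MatrixGroups ComplexConjugate
open NumberField IsDedekindDomain MeasureTheory Complex Filter Topology Polynomial

namespace Literature.NumberTheory.Automorphic

/-! ### The pair Euler product on a far-right half-plane -/

section FarRight

variable {K : Type} [Field K] [NumberField K]

/-- **Absolute convergence of a pair Euler product under polynomial bounds.** If `|a| ≤ q_v^B` for
`a ∈ α v`, `|b| ≤ q_v^{B'}` for `b ∈ β v` (`B, B'` real), `card (α v) ≤ N`, `card (β v) ≤ M` for
`v ∉ S`, then `∑_{v ∉ S} ‖(∏_{a, b} (1 - a b q_v^{-s}))⁻¹ - 1‖ < ∞` for `re s > B + B' + 1`: the pair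
parameters `a b` are bounded by `q_v^{B + B'}` (`norm_le_of_mem_satakeTensor`), so
`‖∏_{a,b} (1 - a b q_v^{-s}) - 1‖ ≤ (2^{NM} - 1) q_v^{B + B' - re s}`
(`norm_eval_eulerPolynomial_sub_one_le`), summable over `v` (`summable_residueCard_rpow_neg`), and
inversion preserves absolute convergence (`summable_norm_inv_sub_one`). The pair analogue of
`absolutelyConvergent_partialStandardL_of_lt_re`; Jacquet–Shalika (1981), (5.1.4): "the infinite
product converges absolutely … in some right half-plane". [folklore] -/
theorem summable_norm_inv_eval_satakePairPolynomial_sub_one_of_rpow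
    {S : Set (HeightOneSpectrum (𝓞 K))} {α β : SatakeFamily K} {N M : ℕ} {B B' : ℝ}
    (hbα : ∀ v ∉ S, ∀ a ∈ α v, ‖a‖ ≤ (v.residueCard : ℝ) ^ B)
    (hbβ : ∀ v ∉ S, ∀ b ∈ β v, ‖b‖ ≤ (v.residueCard : ℝ) ^ B')
    (hcardα : ∀ v ∉ S, Multiset.card (α v) ≤ N) (hcardβ : ∀ v ∉ S, Multiset.card (β v) ≤ M)
    {s : ℂ} (hs : B + B' + 1 < s.re) :
    Summable fun v : {v : HeightOneSpectrum (𝓞 K) // v ∉ S} =>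
      ‖((satakePairPolynomial (α v.1) (β v.1)).eval ((v.1.residueCard : ℂ) ^ (-s)))⁻¹ - 1‖ := by
  have ht1 : 1 < s.re - (B + B') := by linarith
  let b : {v : HeightOneSpectrum (𝓞 K) // v ∉ S} → ℝ := fun v =>
    (2 ^ (N * M) - 1) * (v.1.residueCard : ℝ) ^ (-(s.re - (B + B')))
  have hb : Summable b :=
    ((summable_residueCard_rpow_neg ht1).subtype _).mul_left (2 ^ (N * M) - 1)
  refine summable_norm_inv_sub_one hb fun v => ?_
  have hq1 : (1 : ℝ) < v.1.residueCard := by exact_mod_cast v.1.one_lt_residueCard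
  have hq0 : (0 : ℝ) < v.1.residueCard := zero_lt_one.trans hq1
  have hx : ‖(v.1.residueCard : ℂ) ^ (-s)‖ ≤ (v.1.residueCard : ℝ) ^ (-s.re) := by
    rw [norm_natCast_cpow_of_pos (zero_lt_one.trans v.1.one_lt_residueCard), neg_re]
  have hprod : (v.1.residueCard : ℝ) ^ (B + B') * (v.1.residueCard : ℝ) ^ (-s.re) =
      (v.1.residueCard : ℝ) ^ (-(s.re - (B + B'))) := by
    rw [← Real.rpow_add hq0]
    congr 1
    ring
  have hBt : (v.1.residueCard : ℝ) ^ (B + B') * (v.1.residueCard : ℝ) ^ (-s.re) ≤ 1 := by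
    rw [hprod]
    exact Real.rpow_le_one_of_one_le_of_nonpos hq1.le (by linarith)
  have hγ : ∀ c ∈ satakeTensor (α v.1) (β v.1), ‖c‖ ≤ (v.1.residueCard : ℝ) ^ (B + B') := by
    intro c hc
    rw [Real.rpow_add hq0]
    exact norm_le_of_mem_satakeTensor (hbα v.1 v.2) (hbβ v.1 v.2) hc
  obtain ⟨h1, -⟩ := norm_eval_eulerPolynomial_sub_one_le (Real.rpow_nonneg hq0.le (B + B')) hx
    hBt (satakeTensor (α v.1) (β v.1)) hγ
  rw [satakePairPolynomial_eq_eulerPolynomial]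
  refine h1.trans ?_
  rw [hprod]
  refine mul_le_mul_of_nonneg_right ?_ (Real.rpow_nonneg hq0.le _)
  have hcard : Multiset.card (satakeTensor (α v.1) (β v.1)) ≤ N * M := by
    rw [card_satakeTensor]
    exact Nat.mul_le_mul (hcardα v.1 v.2) (hcardβ v.1 v.2)
  have h2 : (2 : ℝ) ^ Multiset.card (satakeTensor (α v.1) (β v.1)) ≤ 2 ^ (N * M) :=
    pow_le_pow_right₀ one_le_two hcard
  linarith

/-- Hence, under the same polynomial bounds, the pair Euler product
`∏_{v ∉ S} (∏_{a, b} (1 - a b q_v^{-s}))⁻¹` is multipliable on `re s > B + B' + 1`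
(Mathlib `multipliable_one_add_of_summable`). [folklore] -/
theorem multipliable_inv_eval_satakePairPolynomial_of_rpow
    {S : Set (HeightOneSpectrum (𝓞 K))} {α β : SatakeFamily K} {N M : ℕ} {B B' : ℝ}
    (hbα : ∀ v ∉ S, ∀ a ∈ α v, ‖a‖ ≤ (v.residueCard : ℝ) ^ B)
    (hbβ : ∀ v ∉ S, ∀ b ∈ β v, ‖b‖ ≤ (v.residueCard : ℝ) ^ B')
    (hcardα : ∀ v ∉ S, Multiset.card (α v) ≤ N) (hcardβ : ∀ v ∉ S, Multiset.card (β v) ≤ M)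
    {s : ℂ} (hs : B + B' + 1 < s.re) :
    Multipliable fun v : {v : HeightOneSpectrum (𝓞 K) // v ∉ S} =>
      ((satakePairPolynomial (α v.1) (β v.1)).eval ((v.1.residueCard : ℂ) ^ (-s)))⁻¹ := by
  refine (multipliable_one_add_of_summable
    (summable_norm_inv_eval_satakePairPolynomial_sub_one_of_rpow hbα hbβ hcardα hcardβ
      hs)).congr fun v => ?_
  simp only [add_sub_cancel]

/-- **Non-vanishing of the local pair factor far to the right.** If `|a| ≤ q^B` (`a ∈ α`),
`|b| ≤ q^{B'}` (`b ∈ β`) and `re s > B + B'`, then `∏_{a ∈ α, b ∈ β} (1 - a b q^{-s}) ≠ 0`, each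
`a b q^{-s}` having absolute value `≤ q^{B + B' - re s} < 1` (Jacquet–Shalika (1981), p. 555: "the
individual terms in this finite product are of the form `(1 - z)⁻¹` with `|z| < 1`"). [folklore] -/
theorem eval_satakePairPolynomial_ne_zero_of_rpow {α β : Multiset ℂ} {q : ℕ} (hq : 1 < q)
    {B B' : ℝ} (hα : ∀ a ∈ α, ‖a‖ ≤ (q : ℝ) ^ B) (hβ : ∀ b ∈ β, ‖b‖ ≤ (q : ℝ) ^ B') {s : ℂ}
    (hs : B + B' < s.re) : (satakePairPolynomial α β).eval ((q : ℂ) ^ (-s)) ≠ 0 := by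
  rw [satakePairPolynomial_eq_eulerPolynomial, eval_eulerPolynomial]
  refine Multiset.prod_ne_zero fun h0 => ?_
  obtain ⟨c, hc, h⟩ := Multiset.mem_map.mp h0
  have hq0 : (0 : ℝ) < q := by exact_mod_cast (zero_lt_one.trans hq)
  have hq1 : (1 : ℝ) < q := by exact_mod_cast hq
  have hR : 0 ≤ (q : ℝ) ^ B := Real.rpow_nonneg hq0.le B
  have hlt : ‖c * (q : ℂ) ^ (-s)‖ < 1 := by
    rw [norm_mul, norm_natCast_cpow_of_pos (zero_lt_one.trans hq), neg_re]
    calc ‖c‖ * (q : ℝ) ^ (-s.re) ≤ (q : ℝ) ^ B * (q : ℝ) ^ B' * (q : ℝ) ^ (-s.re) :=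
          mul_le_mul_of_nonneg_right (norm_le_of_mem_satakeTensor hα hβ hc)
            (Real.rpow_nonneg hq0.le _)
      _ = (q : ℝ) ^ (B + B' + -s.re) := by rw [← Real.rpow_add hq0, ← Real.rpow_add hq0]
      _ < 1 := Real.rpow_lt_one_of_one_lt_of_neg hq1 (by linarith)
  have h1 : c * (q : ℂ) ^ (-s) = 1 := (sub_eq_zero.mp h).symm
  rw [h1, norm_one] at hlt
  exact lt_irrefl _ hlt

variable {n m : ℕ} {μ : Measure (AdelicGroupData.gl n K).automorphicQuotient}
  [(AdelicGroupData.gl n K).IsAutomorphicMeasure μ]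
  {μ' : Measure (AdelicGroupData.gl m K).automorphicQuotient}
  [(AdelicGroupData.gl m K).IsAutomorphicMeasure μ']

/-- **Absolute convergence of `L^S(s, π ⊗ σ)` on `re s > n² + m² + 3`, unconditionally.** For Satake
families `α` of a cuspidal `π` on `GL_n(𝔸_K)` and `β` of a cuspidal `σ` on `GL_m(𝔸_K)` off `S`,
`∑_{v ∉ S} ‖det(1 - t_{π,v} ⊗ t_{σ,v} q_v^{-s})⁻¹ - 1‖ < ∞` whenever `re s > n² + m² + 3`: the
trivial bounds `|a| ≤ q_v^{n² + 1}`, `|b| ≤ q_v^{m² + 1}` (`IsSatakeFamilyOf.norm_le_rpow`) in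
`summable_norm_inv_eval_satakePairPolynomial_sub_one_of_rpow`. This is the half-plane (5.1.4) of
Jacquet–Shalika (1981) for pairs ("converges absolutely to an analytic function in some right
half-plane"), made explicit; the half-plane `re s > 1` is Thm. (5.3) and needs Lemma (5.2).
[cite: JacquetShalikaAJM1981, (5.1.4)] -/
theorem absolutelyConvergent_partialPairL_of_lt_re {P : CuspidalAutomorphicRepGL n K μ}
    {P' : CuspidalAutomorphicRepGL m K μ'} {S : Set (HeightOneSpectrum (𝓞 K))}
    {α β : SatakeFamily K} (hα : IsSatakeFamilyOf P S α) (hβ : IsSatakeFamilyOf P' S β) {s : ℂ}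
    (hs : (n : ℝ) ^ 2 + (m : ℝ) ^ 2 + 3 < s.re) :
    Summable fun v : {v : HeightOneSpectrum (𝓞 K) // v ∉ S} =>
      ‖((satakePairPolynomial (α v.1) (β v.1)).eval ((v.1.residueCard : ℂ) ^ (-s)))⁻¹ - 1‖ :=
  summable_norm_inv_eval_satakePairPolynomial_sub_one_of_rpow (B := (n : ℝ) ^ 2 + 1)
    (B' := (m : ℝ) ^ 2 + 1)
    (fun _ hv _ ha => hα.norm_le_rpow hv ha) (fun _ hv _ hb => hβ.norm_le_rpow hv hb)
    (fun _ hv => (hα.card_eq hv).le) (fun _ hv => (hβ.card_eq hv).le) (by linarith)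

/-- **The statement of `JacquetShalika1981_multipliable_partialPairL` on the half-plane
`re s > n² + m² + 3`, unconditionally:** the pair Euler product
`∏_{v ∉ S} det(1 - t_{π,v} ⊗ t_{σ,v} q_v^{-s})⁻¹` of two cuspidal representations is multipliable
there (Jacquet–Shalika (1981), (5.1.4), with the explicit half-plane of the trivial bound).
[cite: JacquetShalikaAJM1981, (5.1.4)] -/
theorem multipliable_partialPairL_of_lt_re {P : CuspidalAutomorphicRepGL n K μ}
    {P' : CuspidalAutomorphicRepGL m K μ'} {S : Set (HeightOneSpectrum (𝓞 K))}
    {α β : SatakeFamily K} (hα : IsSatakeFamilyOf P S α) (hβ : IsSatakeFamilyOf P' S β) {s : ℂ}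
    (hs : (n : ℝ) ^ 2 + (m : ℝ) ^ 2 + 3 < s.re) :
    Multipliable fun v : {v : HeightOneSpectrum (𝓞 K) // v ∉ S} =>
      ((satakePairPolynomial (α v.1) (β v.1)).eval ((v.1.residueCard : ℂ) ^ (-s)))⁻¹ := by
  refine (multipliable_one_add_of_summable
    (absolutelyConvergent_partialPairL_of_lt_re hα hβ hs)).congr fun v => ?_
  simp only [add_sub_cancel]

/-- Hence `partialPairL S α β s` is the genuine value (limit of the finite partial products) of the
pair Euler product for `re s > n² + m² + 3`, unconditionally. [folklore] -/
theorem hasProd_partialPairL_of_lt_re {P : CuspidalAutomorphicRepGL n K μ}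
    {P' : CuspidalAutomorphicRepGL m K μ'} {S : Set (HeightOneSpectrum (𝓞 K))}
    {α β : SatakeFamily K} (hα : IsSatakeFamilyOf P S α) (hβ : IsSatakeFamilyOf P' S β) {s : ℂ}
    (hs : (n : ℝ) ^ 2 + (m : ℝ) ^ 2 + 3 < s.re) :
    HasProd (fun v : {v : HeightOneSpectrum (𝓞 K) // v ∉ S} =>
      ((satakePairPolynomial (α v.1) (β v.1)).eval ((v.1.residueCard : ℂ) ^ (-s)))⁻¹)
      (partialPairL S α β s) :=
  (multipliable_partialPairL_of_lt_re hα hβ hs).hasProd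

end FarRight

/-! ### Lemma (5.2) for all finite `S ⊇ S₀` and all Satake families, from one pair `(S₀, α₀)` -/

section OneFamily

variable {n : ℕ} {K : Type} [Field K] [NumberField K]
  {μ : Measure (AdelicGroupData.gl n K).automorphicQuotient}
  [(AdelicGroupData.gl n K).IsAutomorphicMeasure μ]

/-- **Continuation of `L_S(s, α × ᾱ)` from that of `L_{S₀}(s, α₀ × ᾱ₀)`, `S₀ ⊆ S`.** Let `Π` be
cuspidal on `GL_n(𝔸_K)`, `S₀ ⊆ S` finite sets of finite places, `α₀` a Satake family of `Π` off
`S₀` and `α` one off `S`. If `F` is holomorphic on `re s > 1` and equals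
`L_{S₀}(s, α₀ × ᾱ₀) = partialPairL S₀ α₀ (conjFamily α₀) s` for `re s > x₀`, then
`G(s) = F(s) · ∏_{v ∈ S ∖ S₀} P_v(q_v^{-s})`, `P_v(T) = ∏_{a, a' ∈ α₀ v} (1 - a ā' T)`, is holomorphic
on `re s > 1` and equals `L_S(s, α × ᾱ)` for `re s > max(x₀, 2n² + 3)`. Indeed `α = α₀` off `S`
(`IsSatakeFamilyOf.eq_of_not_mem`: Hecke–Satake parameters of `Π` do not depend on level,
eigenvector or uniformiser), and on the half-plane of absolute convergence
(`summable_norm_inv_eval_satakePairPolynomial_sub_one_of_rpow` with the trivial bound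
`|a| ≤ q_v^{n² + 1}`) the product over `v ∉ S₀` splits as the finite product over `S ∖ S₀` times the
product over `v ∉ S` (`Multipliable.tprod_mul_tprod_compl`), the finite factors being non-zero
(`eval_satakePairPolynomial_ne_zero_of_rpow`). This is the bookkeeping implicit in Jacquet–Shalika
(1981), (5.1) ("`S` … large enough") and Cogdell (2003), §4.1. [folklore] -/
theorem exists_continuation_partialPairL_conj_of_subset {P : CuspidalAutomorphicRepGL n K μ}
    {S₀ S : Finset (HeightOneSpectrum (𝓞 K))} (hS : S₀ ⊆ S) {α₀ α : SatakeFamily K}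
    (hα₀ : IsSatakeFamilyOf P ↑S₀ α₀) (hα : IsSatakeFamilyOf P ↑S α) {F : ℂ → ℂ} {x₀ : ℝ}
    (hF : DifferentiableOn ℂ F {s : ℂ | 1 < s.re})
    (hFeq : ∀ s : ℂ, x₀ < s.re → F s = partialPairL ↑S₀ α₀ (conjFamily α₀) s) :
    ∃ (G : ℂ → ℂ) (x₁ : ℝ), DifferentiableOn ℂ G {s : ℂ | 1 < s.re} ∧
      ∀ s : ℂ, x₁ < s.re → G s = partialPairL ↑S α (conjFamily α) s := by
  classical
  -- the local factors `P_v(q_v^{-s})` of the family `α₀ × ᾱ₀`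
  set Pv : HeightOneSpectrum (𝓞 K) → ℂ → ℂ := fun v s =>
    (satakePairPolynomial (α₀ v) (conjFamily α₀ v)).eval ((v.residueCard : ℂ) ^ (-s)) with hPv
  set B : ℝ := (n : ℝ) ^ 2 + 1 with hB
  refine ⟨fun s => F s * ∏ v ∈ S \ S₀, Pv v s, max x₀ (2 * B + 1), ?_, ?_⟩
  · -- holomorphy on `re s > 1`: `F` times finitely many entire functions
    refine hF.mul (Differentiable.fun_finsetProd fun v _ => ?_).differentiableOn
    have hq : (v.residueCard : ℂ) ≠ 0 :=
      Nat.cast_ne_zero.mpr (zero_lt_one.trans v.one_lt_residueCard).ne'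
    exact (Polynomial.differentiable _).comp (differentiable_id.neg.const_cpow (Or.inl hq))
  · intro s hs
    have hx₀ : x₀ < s.re := (le_max_left _ _).trans_lt hs
    have hsB : 2 * B + 1 < s.re := (le_max_right _ _).trans_lt hs
    -- the trivial bound for `α₀` and `ᾱ₀` off `S₀`
    have hb : ∀ v ∉ (↑S₀ : Set (HeightOneSpectrum (𝓞 K))), ∀ a ∈ α₀ v,
        ‖a‖ ≤ (v.residueCard : ℝ) ^ B := fun v hv a ha => hα₀.norm_le_rpow hv ha
    have hbc : ∀ v ∉ (↑S₀ : Set (HeightOneSpectrum (𝓞 K))), ∀ a ∈ conjFamily α₀ v,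
        ‖a‖ ≤ (v.residueCard : ℝ) ^ B := by
      intro v hv a ha
      rw [conjFamily_apply] at ha
      obtain ⟨a', ha', rfl⟩ := Multiset.mem_map.mp ha
      rw [Complex.norm_conj]
      exact hb v hv a' ha'
    have hcard : ∀ v ∉ (↑S₀ : Set (HeightOneSpectrum (𝓞 K))), Multiset.card (α₀ v) ≤ n :=
      fun v hv => (hα₀.card_eq hv).le
    have hcardc : ∀ v ∉ (↑S₀ : Set (HeightOneSpectrum (𝓞 K))),
        Multiset.card (conjFamily α₀ v) ≤ n := fun v hv => by
      rw [conjFamily_apply, Multiset.card_map]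
      exact hcard v hv
    -- the family `f v = P_v(q_v^{-s})⁻¹`, `v ∉ S₀`, converges absolutely at `s`
    set f : {v : HeightOneSpectrum (𝓞 K) // v ∉ (↑S₀ : Set (HeightOneSpectrum (𝓞 K)))} → ℂ :=
      fun v => (Pv v.1 s)⁻¹ with hf
    have habs : Summable fun v => ‖f v - 1‖ :=
      summable_norm_inv_eval_satakePairPolynomial_sub_one_of_rpow hb hbc hcard hcardc (by linarith)
    have hmul : ∀ T : Set {v : HeightOneSpectrum (𝓞 K) // v ∉ (↑S₀ : Set (HeightOneSpectrum (𝓞 K)))},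
        Multipliable (f ∘ (↑) : T → ℂ) := fun T => by
      refine (multipliable_one_add_of_summable (habs.subtype T)).congr fun v => ?_
      simp only [Function.comp_apply, add_sub_cancel]
    -- non-vanishing of the local factors at `s`
    have hne : ∀ v ∉ (↑S₀ : Set (HeightOneSpectrum (𝓞 K))), Pv v s ≠ 0 := fun v hv =>
      eval_satakePairPolynomial_ne_zero_of_rpow v.one_lt_residueCard (hb v hv) (hbc v hv)
        (by linarith)
    -- split the product over `v ∉ S₀` along `T = {v ∈ S}` and its complement
    set T : Set {v : HeightOneSpectrum (𝓞 K) // v ∉ (↑S₀ : Set (HeightOneSpectrum (𝓞 K)))} :=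
      {v | v.1 ∈ S} with hT
    have hsplit : (∏' v : T, f v) * ∏' v : (Tᶜ : Set _), f v = ∏' v, f v :=
      (hmul T).tprod_mul_tprod_compl (hmul Tᶜ)
    -- the part over `T` is the finite product over `S \ S₀`
    let eT : {v : HeightOneSpectrum (𝓞 K) // v ∈ S \ S₀} ≃ T :=
      { toFun := fun v => ⟨⟨v.1, fun h => (Finset.mem_sdiff.mp v.2).2 h⟩,
          (Finset.mem_sdiff.mp v.2).1⟩
        invFun := fun v => ⟨v.1.1, Finset.mem_sdiff.mpr ⟨v.2, v.1.2⟩⟩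
        left_inv := fun _ => rfl
        right_inv := fun _ => rfl }
    have hTprod : ∏' v : T, f v = ∏ v ∈ S \ S₀, (Pv v s)⁻¹ := by
      rw [← eT.tprod_eq (fun v : T => f v), ← Finset.tprod_subtype (S \ S₀) fun v => (Pv v s)⁻¹]
      rfl
    -- the part over `Tᶜ` is the product over `v ∉ S`, i.e. `L_S(s, α × ᾱ)` since `α = α₀` off `S`
    let eC : {v : HeightOneSpectrum (𝓞 K) // v ∉ (↑S : Set (HeightOneSpectrum (𝓞 K)))} ≃
        (Tᶜ : Set _) :=
      { toFun := fun v => ⟨⟨v.1, fun h => v.2 (hS h)⟩, fun h => v.2 h⟩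
        invFun := fun v => ⟨v.1.1, fun h => v.2 h⟩
        left_inv := fun _ => rfl
        right_inv := fun _ => rfl }
    have hCprod : ∏' v : (Tᶜ : Set _), f v = partialPairL ↑S α (conjFamily α) s := by
      rw [← eC.tprod_eq (fun v : (Tᶜ : Set _) => f v)]
      refine tprod_congr fun v => ?_
      have hαv : α v.1 = α₀ v.1 := hα.eq_of_not_mem hα₀ v.2 fun h => v.2 (hS h)
      simp only [hf, hPv, conjFamily_apply, hαv]
      rfl
    -- assemble
    have hFs : F s = ∏' v, f v := hFeq s hx₀
    have hcancel : (∏ v ∈ S \ S₀, (Pv v s)⁻¹) * ∏ v ∈ S \ S₀, Pv v s = 1 := by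
      rw [← Finset.prod_mul_distrib]
      refine Finset.prod_eq_one fun v hv => inv_mul_cancel₀ (hne v ?_)
      exact fun h => (Finset.mem_sdiff.mp hv).2 h
    calc F s * ∏ v ∈ S \ S₀, Pv v s
        = ((∏' v : T, f v) * ∏' v : (Tᶜ : Set _), f v) * ∏ v ∈ S \ S₀, Pv v s := by
          rw [hsplit, hFs]
      _ = ((∏ v ∈ S \ S₀, (Pv v s)⁻¹) * ∏ v ∈ S \ S₀, Pv v s) * ∏' v : (Tᶜ : Set _), f v := by
          rw [hTprod]; ring
      _ = partialPairL ↑S α (conjFamily α) s := by rw [hcancel, one_mul, hCprod]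

/-- **Jacquet–Shalika (1981), Lemma (5.2), one-family form.** The named fact
`JacquetShalika1981_continuation_partialPairL_conj` (for every cuspidal `Π` a finite `S₀` such that
for all finite `S ⊇ S₀` and all Satake families `α` of `Π` off `S`, `L_S(s, π × π̄)` continues
holomorphically to `re s > 1`) follows as soon as, for every cuspidal `Π`, **one** finite `S₀`,
**one** Satake family `α₀` of `Π` off `S₀` and one function `F` holomorphic on `re s > 1` with
`F = L_{S₀}(s, α₀ × ᾱ₀)` on a right half-plane are given
(`exists_continuation_partialPairL_conj_of_subset`). This is the form in which the Rankin–Selberg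
method of loc. cit. §4 produces the lemma: one set `S` "large enough" ((5.1), p. 554) and the
canonical parameters `A_v`, `v ∉ S`. [cite: JacquetShalikaAJM1981, Lemma (5.2), (5.1)] -/
theorem JacquetShalika1981_continuation_partialPairL_conj_of_one_family
    (h : ∀ P : CuspidalAutomorphicRepGL n K μ, ∃ (S₀ : Finset (HeightOneSpectrum (𝓞 K)))
      (α₀ : SatakeFamily K), IsSatakeFamilyOf P ↑S₀ α₀ ∧ ∃ (F : ℂ → ℂ) (x₀ : ℝ),
        DifferentiableOn ℂ F {s : ℂ | 1 < s.re} ∧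
          ∀ s : ℂ, x₀ < s.re → F s = partialPairL ↑S₀ α₀ (conjFamily α₀) s) :
    JacquetShalika1981_continuation_partialPairL_conj (μ := μ) := by
  intro P
  obtain ⟨S₀, α₀, hα₀, F, x₀, hF, hFeq⟩ := h P
  exact ⟨S₀, fun S α hS hα => exists_continuation_partialPairL_conj_of_subset hS hα₀ hα hF hFeq⟩

/-- **Lemma (5.2) from local quotient representations for one family.** If for every cuspidal `Π`
there are one finite `S₀`, one Satake family `α₀` of `Π` off `S₀` and an abscissa `x₀` such that
for every `s₀` with `re s₀ > 1` some `I`, `A` holomorphic on `re s > 1` satisfy `A(s₀) ≠ 0` and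
`I(s) = A(s) · L_{S₀}(s, α₀ × ᾱ₀)` for `re s > max(x₀, 1)` — in the source `I = Ψ(s, W', W, Φ)`, the
integral of `φ' φ` against the mirabolic Eisenstein series (holomorphic on `re s > 1` by (4.6)),
`A = ∏_{v ∈ S₀} Ψ_v`, non-zero at `s₀` for suitable data (§§1, 3), the identity being the Euler
factorisation of §4 with the unramified computation of §2 — then
`JacquetShalika1981_continuation_partialPairL_conj` holds: patch the quotients
(`exists_continuation_partialPairL_of_local_quotients` of `RankinSelbergContinuationGlue`) and pass
to all `(S, α)` (`JacquetShalika1981_continuation_partialPairL_conj_of_one_family`). Compare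
`JacquetShalika1981_continuation_partialPairL_conj_of_local_quotients`, which asks for the
quotient data for every finite `S ⊇ S₀` and every Satake family.
[cite: JacquetShalikaAJM1981, Lemma (5.2), p. 554–555] -/
theorem JacquetShalika1981_continuation_partialPairL_conj_of_local_quotients_one_family
    (h : ∀ P : CuspidalAutomorphicRepGL n K μ, ∃ (S₀ : Finset (HeightOneSpectrum (𝓞 K)))
      (α₀ : SatakeFamily K), IsSatakeFamilyOf P ↑S₀ α₀ ∧ ∃ x₀ : ℝ, ∀ s₀ : ℂ, 1 < s₀.re →
        ∃ I A : ℂ → ℂ, DifferentiableOn ℂ I {s : ℂ | 1 < s.re} ∧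
          DifferentiableOn ℂ A {s : ℂ | 1 < s.re} ∧ A s₀ ≠ 0 ∧
            ∀ s : ℂ, 1 < s.re → x₀ < s.re →
              I s = A s * partialPairL ↑S₀ α₀ (conjFamily α₀) s) :
    JacquetShalika1981_continuation_partialPairL_conj (μ := μ) := by
  refine JacquetShalika1981_continuation_partialPairL_conj_of_one_family fun P => ?_
  obtain ⟨S₀, α₀, hα₀, x₀, hx₀⟩ := h P
  obtain ⟨F, x₁, hF, hFeq⟩ := exists_continuation_partialPairL_of_local_quotients hx₀
  exact ⟨S₀, α₀, hα₀, F, x₁, hF, hFeq⟩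

end OneFamily

/-! ### The fact for pairs: conditional assemblies and the unconditional cases -/

section Pairs

variable {n m : ℕ} {K : Type} [Field K] [NumberField K]
  {μ : Measure (AdelicGroupData.gl n K).automorphicQuotient}
  [(AdelicGroupData.gl n K).IsAutomorphicMeasure μ]
  {μ' : Measure (AdelicGroupData.gl m K).automorphicQuotient}
  [(AdelicGroupData.gl m K).IsAutomorphicMeasure μ']

/-- **Jacquet–Shalika's Thm. (5.3) for pairs from one-family continuation data at `GL_n` and at
`GL_m`:** if for every cuspidal representation of `GL_n(𝔸_K)` (in `L²(μ)`) and of `GL_m(𝔸_K)` (in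
`L²(μ')`) the partial `L`-function `L_{S₀}(s, π × π̄)` of *one* Satake family off *one* finite `S₀`
continues holomorphically to `re s > 1`, then `JacquetShalika1981_multipliable_partialPairL` holds
(`JacquetShalika1981_continuation_partialPairL_conj_of_one_family` at `n` and at `m`, then
`JacquetShalika1981_multipliable_partialPairL_of_continuation_partialPairL`).
[cite: JacquetShalikaAJM1981, Thm. (5.3), Lemma (5.2)] -/
theorem JacquetShalika1981_multipliable_partialPairL_of_one_family
    (h : ∀ P : CuspidalAutomorphicRepGL n K μ, ∃ (S₀ : Finset (HeightOneSpectrum (𝓞 K)))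
      (α₀ : SatakeFamily K), IsSatakeFamilyOf P ↑S₀ α₀ ∧ ∃ (F : ℂ → ℂ) (x₀ : ℝ),
        DifferentiableOn ℂ F {s : ℂ | 1 < s.re} ∧
          ∀ s : ℂ, x₀ < s.re → F s = partialPairL ↑S₀ α₀ (conjFamily α₀) s)
    (h' : ∀ P' : CuspidalAutomorphicRepGL m K μ', ∃ (S₀ : Finset (HeightOneSpectrum (𝓞 K)))
      (β₀ : SatakeFamily K), IsSatakeFamilyOf P' ↑S₀ β₀ ∧ ∃ (F : ℂ → ℂ) (x₀ : ℝ),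
        DifferentiableOn ℂ F {s : ℂ | 1 < s.re} ∧
          ∀ s : ℂ, x₀ < s.re → F s = partialPairL ↑S₀ β₀ (conjFamily β₀) s) :
    JacquetShalika1981_multipliable_partialPairL (n := n) (m := m) (K := K) (μ := μ) (μ' := μ') :=
  JacquetShalika1981_multipliable_partialPairL_of_continuation_partialPairL
    (JacquetShalika1981_continuation_partialPairL_conj_of_one_family h)
    (JacquetShalika1981_continuation_partialPairL_conj_of_one_family h')

/-- **`JacquetShalika1981_multipliable_partialPairL` holds unconditionally in ranks `n, m ≤ 1`** —
the absolute convergence on `re s > 1` of the partial Euler products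
`∏_{v ∉ S} (1 - χ_v(ϖ_v) χ'_v(ϖ_v) q_v^{-s})⁻¹` of pairs of unitary idele class characters (Hecke;
Tate's thesis), over the tree's honest `L²`/Hecke-operator objects: Lemma (5.2) is a theorem for
`n ≤ 1` (`continuation_partialPairL_conj_of_le_one` of `SatakeParameterUnitBound`: the Hecke–Satake
parameters have absolute value `1`, so `L_S(s, χ × χ̄)` is holomorphic on `re s > 1` and is its own
continuation), at `n` and at `m`. (`n = 0` or `m = 0` is the degenerate case of empty
parameters.) [cite: JacquetShalikaAJM1981, Thm. (5.3)] -/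
theorem JacquetShalika1981_multipliable_partialPairL_of_le_one (hn : n ≤ 1) (hm : m ≤ 1) :
    JacquetShalika1981_multipliable_partialPairL (n := n) (m := m) (K := K) (μ := μ) (μ' := μ') :=
  JacquetShalika1981_multipliable_partialPairL_of_continuation_partialPairL
    (continuation_partialPairL_conj_of_le_one hn) (continuation_partialPairL_conj_of_le_one hm)

/-- **`JacquetShalika1981_multipliable_partialPairL` under the Ramanujan conjecture** (clause (i) of
`Literature.NumberTheory.Automorphic.RamanujanConjectureGL`, `|a| = 1` for the Hecke–Satake parameters) at `n` and at `m`: then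
Lemma (5.2) holds with the Euler product as its own continuation
(`continuation_partialPairL_conj_of_ramanujan`). A documented conditional (the conjecture is open
in general); the unconditional route is Lemma (5.2). [cite: JacquetShalikaAJM1981, Thm. (5.3)] -/
theorem JacquetShalika1981_multipliable_partialPairL_of_ramanujan
    (hRn : Literature.NumberTheory.Automorphic.RamanujanConjectureGL n) (hRm : Literature.NumberTheory.Automorphic.RamanujanConjectureGL m) :
    JacquetShalika1981_multipliable_partialPairL (n := n) (m := m) (K := K) (μ := μ) (μ' := μ') :=
  JacquetShalika1981_multipliable_partialPairL_of_continuation_partialPairL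
    (continuation_partialPairL_conj_of_ramanujan hRn) (continuation_partialPairL_conj_of_ramanujan hRm)

end Pairs

/-! ### The positivity form of the remaining input: (5.3.3) for one family

Jacquet–Shalika's Thm. (5.3) for pairs is assembled in the tree along two interchangeable last
miles: from **Lemma (5.2)** (the continuation of `L_S(s, π × π̄)`, then Landau's lemma;
`JacquetShalika1981_multipliable_partialPairL_of_continuation_partialPairL`) or directly from
**(5.3.3)–(5.3.4)**, the convergence of `∑_{v ∉ S} ∑_k |tr A_v^k|² / (k q_v^{kσ})` for real `σ > 1`
(`summable_normSq_trace_satakePow`; `JacquetShalika1981_multipliable_partialPairL_of_summable` of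
`JacquetShalikaEulerProducts`). The theorems below reduce the second input, like the first, to
**one** finite exceptional set and **one** Satake family per cuspidal `Π`, and record that in the
tree the two named inputs imply each other. The series (5.3.3) has non-negative terms, so its
convergence at real `σ > 1` is a statement free of complex analysis: it is what the Rankin–Selberg
unfolding yields at a real point by positivity (`|W|² ≥ 0`, Tonelli), without analytic
continuation, Landau's lemma or the non-vanishing of local integrals at complex points. -/

section Summability

variable {n : ℕ} {K : Type} [Field K] [NumberField K]
  {μ : Measure (AdelicGroupData.gl n K).automorphicQuotient}
  [(AdelicGroupData.gl n K).IsAutomorphicMeasure μ]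

/-- **Sub-series transfer for (5.3.3).** If `S ⊇ S₀` pointwise (`v ∉ S → v ∉ S₀`) and `α = α₀` off
`S`, the convergence of `∑_{v ∉ S₀} ∑_k |p_k(α₀ v)|² / (k q_v^{kσ})` implies that of
`∑_{v ∉ S} ∑_k |p_k(α v)|² / (k q_v^{kσ})` (a sub-family of a summable family of reals, through the
injection `ℕ × {v ∉ S} ↪ ℕ × {v ∉ S₀}`). [folklore] -/
theorem summable_normSq_trace_of_forall_not_mem {S S₀ : Set (HeightOneSpectrum (𝓞 K))}
    {α α₀ : SatakeFamily K} (hS : ∀ v ∉ S, v ∉ S₀) (heq : ∀ v ∉ S, α v = α₀ v) {σ : ℝ}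
    (hsum : Summable fun kv : ℕ × {v : HeightOneSpectrum (𝓞 K) // v ∉ S₀} =>
      ‖((α₀ kv.2.1).map (· ^ (kv.1 + 1))).sum‖ ^ 2 /
        ((kv.1 + 1 : ℝ) * (kv.2.1.residueCard : ℝ) ^ ((kv.1 + 1 : ℝ) * σ))) :
    Summable fun kv : ℕ × {v : HeightOneSpectrum (𝓞 K) // v ∉ S} =>
      ‖((α kv.2.1).map (· ^ (kv.1 + 1))).sum‖ ^ 2 /
        ((kv.1 + 1 : ℝ) * (kv.2.1.residueCard : ℝ) ^ ((kv.1 + 1 : ℝ) * σ)) := by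
  let ι : ℕ × {v : HeightOneSpectrum (𝓞 K) // v ∉ S} →
      ℕ × {v : HeightOneSpectrum (𝓞 K) // v ∉ S₀} :=
    fun kv => (kv.1, ⟨kv.2.1, hS kv.2.1 kv.2.2⟩)
  have hι : Function.Injective ι := by
    rintro ⟨k, v⟩ ⟨k', v'⟩ h
    simp only [ι, Prod.mk.injEq, Subtype.mk.injEq] at h
    exact Prod.ext h.1 (Subtype.ext h.2)
  refine (hsum.comp_injective hι).congr fun kv => ?_
  simp only [Function.comp_apply, ι, heq kv.2.1 kv.2.2]

/-- **`L_S(s, α × ᾱ)` is holomorphic on `re s > 1` once (5.3.3) converges for every `σ > 1`.** For a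
Satake family `α` of a cuspidal `Π` off `S` with `∑_{v ∉ S} ∑_k |tr α(v)^k|² / (k q_v^{kσ}) < ∞` for
all real `σ > 1`, the function `exp (∑_N a_N N^{-s})` — the exponential of the Dirichlet series
(5.3.3) over `ℕ` (`normSqTraceSeries`), whose abscissa of absolute convergence is then `≤ 1` — is
holomorphic on `re s > 1` and equals the Euler product `partialPairL S α ᾱ s` on the far-right
half-plane `re s > 2 (n² + 1) + 1` where the latter converges absolutely by the proved trivial
bound `|a| ≤ q_v^{n² + 1}` (`IsSatakeFamilyOf.norm_le_rpow`,
`partialPairL_conjFamily_eq_exp_LSeries_of_rpow`). Jacquet–Shalika (1981), p. 556, (2)–(4), read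
at the abscissa `σ = 1`. [folklore] -/
theorem differentiableOn_exp_normSqTraceSeries_of_summable {P : CuspidalAutomorphicRepGL n K μ}
    {S : Set (HeightOneSpectrum (𝓞 K))} {α : SatakeFamily K} (hα : IsSatakeFamilyOf P S α)
    (hsum : ∀ ⦃σ : ℝ⦄, 1 < σ → Summable fun kv : ℕ × {v : HeightOneSpectrum (𝓞 K) // v ∉ S} =>
      ‖((α kv.2.1).map (· ^ (kv.1 + 1))).sum‖ ^ 2 /
        ((kv.1 + 1 : ℝ) * (kv.2.1.residueCard : ℝ) ^ ((kv.1 + 1 : ℝ) * σ))) :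
    DifferentiableOn ℂ (fun s => Complex.exp (LSeries (normSqTraceSeries S α) s))
        {s : ℂ | 1 < s.re} ∧
      ∀ s : ℂ, 2 * ((n : ℝ) ^ 2 + 1) + 1 < s.re →
        Complex.exp (LSeries (normSqTraceSeries S α) s) = partialPairL S α (conjFamily α) s := by
  have habs : LSeries.abscissaOfAbsConv (normSqTraceSeries S α) ≤ (1 : ℝ) :=
    LSeries.abscissaOfAbsConv_le_of_forall_lt_LSeriesSummable fun y hy =>
      (summable_jsCoeff_mul_rpow_neg_iff S α y).mp
        ((hsum (by exact_mod_cast hy)).congr fun i => (jsCoeff_mul_rpow_neg S α y i).symm)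
  refine ⟨?_, fun s hs => ?_⟩
  · refine ((LSeries_differentiableOn _).mono fun s hs => ?_).cexp
    exact lt_of_le_of_lt habs (by exact_mod_cast hs)
  · exact (partialPairL_conjFamily_eq_exp_LSeries_of_rpow (fun v hv a ha => hα.norm_le_rpow hv ha)
      (fun v hv => (hα.card_eq hv).le) hs).symm

/-- **(5.3.3) implies Lemma (5.2)**: the named fact `summable_normSq_trace_satakePow`
((5.3.3)–(5.3.4) for every Satake family of every cuspidal `Π`) implies the named fact
`JacquetShalika1981_continuation_partialPairL_conj` (Lemma (5.2)), with `S₀ = ∅`, the continuation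
`exp (∑_N a_N N^{-s})` and the abscissa `x₀ = 2 (n² + 1) + 1`
(`differentiableOn_exp_normSqTraceSeries_of_summable`). The converse implication, for the finite
exceptional sets of the lemma, is Landau's lemma (`summable_normSq_trace_of_continuation_of_rpow` of
`SatakeParameterTrivialBound`); so in the tree the two named inputs of Thm. (5.3) are interchangeable.
[cite: JacquetShalikaAJM1981, Lemma (5.2), Thm. (5.3) proof, (5.3.3)–(5.3.4)] -/
theorem continuation_partialPairL_conj_of_summable (h₂ : summable_normSq_trace_satakePow (μ := μ)) :
    JacquetShalika1981_continuation_partialPairL_conj (μ := μ) := fun P =>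
  ⟨∅, fun S α _ hα =>
    ⟨fun s => Complex.exp (LSeries (normSqTraceSeries (↑S) α) s), 2 * ((n : ℝ) ^ 2 + 1) + 1,
      (differentiableOn_exp_normSqTraceSeries_of_summable hα fun _ hσ => h₂ P hα hσ).1,
      (differentiableOn_exp_normSqTraceSeries_of_summable hα fun _ hσ => h₂ P hα hσ).2⟩⟩

/-- **(5.3.3) for one family per representation suffices.** If for every cuspidal `Π` there are a
finite set `S₀` *of ramified places of `Π`*, a Satake family `α₀` of `Π` off `S₀`, and the
convergence of `∑_{v ∉ S₀} ∑_k |tr α₀(v)^k|² / (k q_v^{kσ})` for every real `σ > 1`, then the named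
fact `summable_normSq_trace_satakePow` holds — for every `S` and every Satake family `α` of `Π` off
`S`: the places off `S` are unramified, hence off `S₀`, and there `α = α₀` (uniqueness of
Hecke–Satake parameters, `IsSatakeFamilyOf.eq_of_not_mem`), so the series for `(S, α)` is a
sub-series of the one for `(S₀, α₀)`. With `S₀` the exact set of ramified places this is the shape
in which the Rankin–Selberg unfolding at a real point `σ > 1` delivers (5.3.3).
[cite: JacquetShalikaAJM1981, Thm. (5.3) proof, (5.3.3)–(5.3.4)] -/
theorem summable_normSq_trace_satakePow_of_one_family
    (h : ∀ P : CuspidalAutomorphicRepGL n K μ, ∃ (S₀ : Finset (HeightOneSpectrum (𝓞 K)))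
      (α₀ : SatakeFamily K), (∀ v ∈ S₀, ¬ IsUnramifiedAt P.1 v) ∧ IsSatakeFamilyOf P ↑S₀ α₀ ∧
        ∀ ⦃σ : ℝ⦄, 1 < σ →
          Summable fun kv : ℕ × {v : HeightOneSpectrum (𝓞 K) // v ∉ (↑S₀ : Set _)} =>
            ‖((α₀ kv.2.1).map (· ^ (kv.1 + 1))).sum‖ ^ 2 /
              ((kv.1 + 1 : ℝ) * (kv.2.1.residueCard : ℝ) ^ ((kv.1 + 1 : ℝ) * σ))) :
    summable_normSq_trace_satakePow (μ := μ) := by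
  intro P S α hα σ hσ
  obtain ⟨S₀, α₀, hram, hα₀, hsum⟩ := h P
  have hS : ∀ v ∉ S, v ∉ (↑S₀ : Set (HeightOneSpectrum (𝓞 K))) :=
    fun v hv hv₀ => hram v hv₀ (hα.isUnramifiedAt hv)
  exact summable_normSq_trace_of_forall_not_mem hS
    (fun v hv => hα.eq_of_not_mem hα₀ hv (hS v hv)) (hsum hσ)

/-- **(5.3.3) for one family off an arbitrary finite `S₀`, plus (5.1.3).** The variant of
`summable_normSq_trace_satakePow_of_one_family` in the printed logical order: `S₀` is any finite set
("`S` large enough", (5.1)) — not necessarily consisting of ramified places — and the finitely many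
unramified places inside `S₀` are covered by the local bound (5.1.3) `|a| ≤ q_v^{1/2}` (Cor. (2.5),
the named fact `norm_satakeParameter_le_sqrt`), each contributing a geometric series
(`summable_normSq_powerSum_div_of_sqrt`); compare `summable_normSq_trace_satakePow_of_lemma52` of
`JacquetShalikaEulerProducts`, the same bookkeeping from Lemma (5.2).
[cite: JacquetShalikaAJM1981, Thm. (5.3) proof, (5.1.3), (5.3.3)–(5.3.4)] -/
theorem summable_normSq_trace_satakePow_of_sqrt_of_one_family
    (h₁ : norm_satakeParameter_le_sqrt (μ := μ))
    (h : ∀ P : CuspidalAutomorphicRepGL n K μ, ∃ (S₀ : Finset (HeightOneSpectrum (𝓞 K)))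
      (α₀ : SatakeFamily K), IsSatakeFamilyOf P ↑S₀ α₀ ∧ ∀ ⦃σ : ℝ⦄, 1 < σ →
        Summable fun kv : ℕ × {v : HeightOneSpectrum (𝓞 K) // v ∉ (↑S₀ : Set _)} =>
          ‖((α₀ kv.2.1).map (· ^ (kv.1 + 1))).sum‖ ^ 2 /
            ((kv.1 + 1 : ℝ) * (kv.2.1.residueCard : ℝ) ^ ((kv.1 + 1 : ℝ) * σ))) :
    summable_normSq_trace_satakePow (μ := μ) := by
  intro P S α hα σ hσ
  obtain ⟨S₀, α₀, hα₀, hsum⟩ := h P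
  -- the series for `(↑S₀ ∪ S, α)` is a sub-series of the one for `(S₀, α₀)`
  have hT : Summable fun kv : ℕ × {v : HeightOneSpectrum (𝓞 K) // v ∉ (↑S₀ ∪ S : Set _)} =>
      ‖((α kv.2.1).map (· ^ (kv.1 + 1))).sum‖ ^ 2 /
        ((kv.1 + 1 : ℝ) * (kv.2.1.residueCard : ℝ) ^ ((kv.1 + 1 : ℝ) * σ)) :=
    summable_normSq_trace_of_forall_not_mem (fun v hv hv₀ => hv (Or.inl hv₀))
      (fun v hv => hα.eq_of_not_mem hα₀ (fun hvS => hv (Or.inr hvS)) fun hv₀ => hv (Or.inl hv₀))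
      (hsum hσ)
  -- add the finitely many unramified places of `S₀ ∖ S`, by (5.1.3)
  let g : ℕ × HeightOneSpectrum (𝓞 K) → ℝ := fun kv =>
    ‖((α kv.2).map (· ^ (kv.1 + 1))).sum‖ ^ 2 /
      ((kv.1 + 1 : ℝ) * (kv.2.residueCard : ℝ) ^ ((kv.1 + 1 : ℝ) * σ))
  have hg : 0 ≤ g := fun kv => by positivity
  have hF : ((↑S₀ : Set (HeightOneSpectrum (𝓞 K))) \ S).Finite :=
    S₀.finite_toSet.subset Set.sdiff_subset
  have hsub : (↑S₀ ∪ S : Set (HeightOneSpectrum (𝓞 K))) ⊆ S ∪ (↑S₀ \ S) := by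
    intro v hv
    by_cases hvS : v ∈ S
    · exact Or.inl hvS
    · rcases hv with hv₀ | hvS'
      · exact Or.inr ⟨hv₀, hvS⟩
      · exact (hvS hvS').elim
  have hfib : ∀ v ∈ (↑S₀ : Set (HeightOneSpectrum (𝓞 K))) \ S, Summable fun k : ℕ => g (k, v) :=
    fun v hv => summable_normSq_powerSum_div_of_sqrt v.one_lt_residueCard
      (fun a ha => h₁ P hα hv.2 ha) (hα.card_eq hv.2).le hσ
  exact summable_prod_compl_of_subset_union_finite (g := g) hg hF hsub hT hfib

end Summability

/-! ### The fact for pairs from one-family summability data -/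

section PairsSummability

variable {n m : ℕ} {K : Type} [Field K] [NumberField K]
  {μ : Measure (AdelicGroupData.gl n K).automorphicQuotient}
  [(AdelicGroupData.gl n K).IsAutomorphicMeasure μ]
  {μ' : Measure (AdelicGroupData.gl m K).automorphicQuotient}
  [(AdelicGroupData.gl m K).IsAutomorphicMeasure μ']

/-- **Jacquet–Shalika's Thm. (5.3) for pairs from one-family summability data at `GL_n` and at
`GL_m`.** If for every cuspidal representation of `GL_n(𝔸_K)` (in `L²(μ)`) and of `GL_m(𝔸_K)` (in
`L²(μ')`) the series `∑_{v ∉ S₀} ∑_k |tr A_v^k|² / (k q_v^{kσ})` of *one* Satake family off *one*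
finite set `S₀` of ramified places converges for every real `σ > 1`, then
`JacquetShalika1981_multipliable_partialPairL` holds
(`summable_normSq_trace_satakePow_of_one_family` at `n` and at `m`, then
`JacquetShalika1981_multipliable_partialPairL_of_summable`: Cauchy–Schwarz (5.3.5)).
[cite: JacquetShalikaAJM1981, Thm. (5.3), (5.3.3)–(5.3.5)] -/
theorem JacquetShalika1981_multipliable_partialPairL_of_one_family_summable
    (h : ∀ P : CuspidalAutomorphicRepGL n K μ, ∃ (S₀ : Finset (HeightOneSpectrum (𝓞 K)))
      (α₀ : SatakeFamily K), (∀ v ∈ S₀, ¬ IsUnramifiedAt P.1 v) ∧ IsSatakeFamilyOf P ↑S₀ α₀ ∧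
        ∀ ⦃σ : ℝ⦄, 1 < σ →
          Summable fun kv : ℕ × {v : HeightOneSpectrum (𝓞 K) // v ∉ (↑S₀ : Set _)} =>
            ‖((α₀ kv.2.1).map (· ^ (kv.1 + 1))).sum‖ ^ 2 /
              ((kv.1 + 1 : ℝ) * (kv.2.1.residueCard : ℝ) ^ ((kv.1 + 1 : ℝ) * σ)))
    (h' : ∀ P' : CuspidalAutomorphicRepGL m K μ', ∃ (S₀ : Finset (HeightOneSpectrum (𝓞 K)))
      (β₀ : SatakeFamily K), (∀ v ∈ S₀, ¬ IsUnramifiedAt P'.1 v) ∧ IsSatakeFamilyOf P' ↑S₀ β₀ ∧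
        ∀ ⦃σ : ℝ⦄, 1 < σ →
          Summable fun kv : ℕ × {v : HeightOneSpectrum (𝓞 K) // v ∉ (↑S₀ : Set _)} =>
            ‖((β₀ kv.2.1).map (· ^ (kv.1 + 1))).sum‖ ^ 2 /
              ((kv.1 + 1 : ℝ) * (kv.2.1.residueCard : ℝ) ^ ((kv.1 + 1 : ℝ) * σ))) :
    JacquetShalika1981_multipliable_partialPairL (n := n) (m := m) (K := K) (μ := μ) (μ' := μ') :=
  JacquetShalika1981_multipliable_partialPairL_of_summable
    (summable_normSq_trace_satakePow_of_one_family h)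
    (summable_normSq_trace_satakePow_of_one_family h')

/-- **Jacquet–Shalika's Thm. (5.3) for pairs from (5.3.3) off finite exceptional sets** at `GL_n`
and at `GL_m` — the printed generality of (5.3.3), `S` finite ((5.1)) — via
`summable_normSq_trace_satakePow_of_finset` of `SummableNormSqTraceSatakePow` and
`JacquetShalika1981_multipliable_partialPairL_of_summable`.
[cite: JacquetShalikaAJM1981, Thm. (5.3), (5.3.3)–(5.3.5)] -/
theorem JacquetShalika1981_multipliable_partialPairL_of_finset_summable
    (h : ∀ (P : CuspidalAutomorphicRepGL n K μ) (S₀ : Finset (HeightOneSpectrum (𝓞 K)))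
      (α₀ : SatakeFamily K), IsSatakeFamilyOf P ↑S₀ α₀ → ∀ σ : ℝ, 1 < σ →
        Summable fun kv : ℕ × {v : HeightOneSpectrum (𝓞 K) // v ∉ (↑S₀ : Set _)} =>
          ‖((α₀ kv.2.1).map (· ^ (kv.1 + 1))).sum‖ ^ 2 /
            ((kv.1 + 1 : ℝ) * (kv.2.1.residueCard : ℝ) ^ ((kv.1 + 1 : ℝ) * σ)))
    (h' : ∀ (P' : CuspidalAutomorphicRepGL m K μ') (S₀ : Finset (HeightOneSpectrum (𝓞 K)))
      (β₀ : SatakeFamily K), IsSatakeFamilyOf P' ↑S₀ β₀ → ∀ σ : ℝ, 1 < σ →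
        Summable fun kv : ℕ × {v : HeightOneSpectrum (𝓞 K) // v ∉ (↑S₀ : Set _)} =>
          ‖((β₀ kv.2.1).map (· ^ (kv.1 + 1))).sum‖ ^ 2 /
            ((kv.1 + 1 : ℝ) * (kv.2.1.residueCard : ℝ) ^ ((kv.1 + 1 : ℝ) * σ))) :
    JacquetShalika1981_multipliable_partialPairL (n := n) (m := m) (K := K) (μ := μ) (μ' := μ') :=
  JacquetShalika1981_multipliable_partialPairL_of_summable
    (summable_normSq_trace_satakePow_of_finset h) (summable_normSq_trace_satakePow_of_finset h')

/-- **The mixed case `m ≤ 1`:** one-family summability data at `GL_n` alone give the fact for pairs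
`GL_n × GL_m` with `m ≤ 1` (twists of `π` by unitary idele class characters), the rank-`≤ 1` input
being unconditional (`summable_normSq_trace_satakePow_of_le_one` of `SatakeParameterUnitBound`).
[cite: JacquetShalikaAJM1981, Thm. (5.3)] -/
theorem JacquetShalika1981_multipliable_partialPairL_of_one_family_summable_of_le_one
    (h : ∀ P : CuspidalAutomorphicRepGL n K μ, ∃ (S₀ : Finset (HeightOneSpectrum (𝓞 K)))
      (α₀ : SatakeFamily K), (∀ v ∈ S₀, ¬ IsUnramifiedAt P.1 v) ∧ IsSatakeFamilyOf P ↑S₀ α₀ ∧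
        ∀ ⦃σ : ℝ⦄, 1 < σ →
          Summable fun kv : ℕ × {v : HeightOneSpectrum (𝓞 K) // v ∉ (↑S₀ : Set _)} =>
            ‖((α₀ kv.2.1).map (· ^ (kv.1 + 1))).sum‖ ^ 2 /
              ((kv.1 + 1 : ℝ) * (kv.2.1.residueCard : ℝ) ^ ((kv.1 + 1 : ℝ) * σ)))
    (hm : m ≤ 1) :
    JacquetShalika1981_multipliable_partialPairL (n := n) (m := m) (K := K) (μ := μ) (μ' := μ') :=
  JacquetShalika1981_multipliable_partialPairL_of_summable
    (summable_normSq_trace_satakePow_of_one_family h) (summable_normSq_trace_satakePow_of_le_one hm)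

end PairsSummability

/-! ### The fact for pairs from (J), and from bounded unramified torus sums, at `GL_n` and `GL_m` -/

section PairsLargeFinset

variable {n m : ℕ} {K : Type} [Field K] [NumberField K]
  {μ : Measure (AdelicGroupData.gl n K).automorphicQuotient}
  [(AdelicGroupData.gl n K).IsAutomorphicMeasure μ]
  {μ' : Measure (AdelicGroupData.gl m K).automorphicQuotient}
  [(AdelicGroupData.gl m K).IsAutomorphicMeasure μ']

/-- **Jacquet–Shalika's Thm. (5.3) for pairs from (J) at `GL_n` and at `GL_m`.** If (5.3.3)–(5.3.4)
hold off large finite sets for every cuspidal representation of `GL_n(𝔸_K)` (in `L²(μ)`) and of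
`GL_m(𝔸_K)` (in `L²(μ')`) — the junction `summable_normSq_trace_largeFinset` of
`JacquetShalikaLargeFinset`, i.e. (5.3.3)–(5.3.4) of the source in their printed generality — then
`JacquetShalika1981_multipliable_partialPairL` holds. The proof of
`JacquetShalika1981_multipliable_partialPairL_of_lemma52'` verbatim with (J) for its first two lines:
enlarge both Satake families to a common finite `S₂ ⊇ S₀ ∪ S₀'` (`exists_finset_isSatakeFamilyOf_extend`
with the discharged Flath input `exists_isSatakeFamilyOf_holds`); off `S₂`, (J) gives (5.3.3) for both
families, hence (5.1.3) for both (`norm_le_sqrt_of_summable_normSq_trace`), so the analytic core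
`multipliable_inv_satakePairPolynomial` (Cauchy–Schwarz (5.3.5) and (2), loc. cit. p. 556) applies
off `S ∪ S₂`; the finitely many factors at `v ∈ S₂ ∖ S` are put back
(`multipliable_compl_of_union_finite`). [cite: JacquetShalikaAJM1981, Thm. (5.3), proof pp. 555–557] -/
theorem JacquetShalika1981_multipliable_partialPairL_of_largeFinset
    (hJ : summable_normSq_trace_largeFinset (μ := μ))
    (hJ' : summable_normSq_trace_largeFinset (μ := μ')) :
    JacquetShalika1981_multipliable_partialPairL (n := n) (m := m) (K := K) (μ := μ) (μ' := μ') := by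
  classical
  intro P P' S α β hα hβ s hs
  obtain ⟨S₀, hS₀⟩ := hJ P
  obtain ⟨S₀', hS₀'⟩ := hJ' P'
  obtain ⟨S₁, α₁, hS₁, -, hα₁, hαα₁⟩ := exists_finset_isSatakeFamilyOf_extend
    (exists_isSatakeFamilyOf_holds (μ := μ)) P (S₀ ∪ S₀') hα
  obtain ⟨S₂, β₂, hS₂, -, hβ₂, hββ₂⟩ := exists_finset_isSatakeFamilyOf_extend
    (exists_isSatakeFamilyOf_holds (μ := μ')) P' S₁ hβ
  have hα₂ : IsSatakeFamilyOf P ↑S₂ α₁ := hα₁.mono (Finset.coe_subset.mpr hS₂)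
  have hA : ∀ ⦃σ : ℝ⦄, 1 < σ →
      Summable fun kv : ℕ × {v : HeightOneSpectrum (𝓞 K) // v ∉ (↑S₂ : Set _)} =>
        ‖((α₁ kv.2.1).map (· ^ (kv.1 + 1))).sum‖ ^ 2 /
          ((kv.1 + 1 : ℝ) * (kv.2.1.residueCard : ℝ) ^ ((kv.1 + 1 : ℝ) * σ)) :=
    fun σ hσ => hS₀ ((Finset.subset_union_left.trans hS₁).trans hS₂) hα₂ hσ
  have hB : ∀ ⦃σ : ℝ⦄, 1 < σ →
      Summable fun kv : ℕ × {v : HeightOneSpectrum (𝓞 K) // v ∉ (↑S₂ : Set _)} =>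
        ‖((β₂ kv.2.1).map (· ^ (kv.1 + 1))).sum‖ ^ 2 /
          ((kv.1 + 1 : ℝ) * (kv.2.1.residueCard : ℝ) ^ ((kv.1 + 1 : ℝ) * σ)) :=
    fun σ hσ => hS₀' ((Finset.subset_union_right.trans hS₁).trans hS₂) hβ₂ hσ
  -- off `S ∪ S₂`
  have hbα : ∀ v ∉ S ∪ ↑S₂, ∀ a ∈ α₁ v, ‖a‖ ≤ Real.sqrt v.residueCard := fun v hv a ha =>
    norm_le_sqrt_of_summable_normSq_trace (fun σ hσ => hA hσ) (fun h => hv (Or.inr h)) ha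
  have hbβ : ∀ v ∉ S ∪ ↑S₂, ∀ b ∈ β₂ v, ‖b‖ ≤ Real.sqrt v.residueCard := fun v hv b hb =>
    norm_le_sqrt_of_summable_normSq_trace (fun σ hσ => hB hσ) (fun h => hv (Or.inr h)) hb
  have hA' : Summable fun kv : ℕ × {v : HeightOneSpectrum (𝓞 K) // v ∉ S ∪ ↑S₂} =>
      ‖((α₁ kv.2.1).map (· ^ (kv.1 + 1))).sum‖ ^ 2 /
        ((kv.1 + 1 : ℝ) * (kv.2.1.residueCard : ℝ) ^ ((kv.1 + 1 : ℝ) * s.re)) :=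
    summable_prod_compl_union_of_summable
      (fun kv : ℕ × HeightOneSpectrum (𝓞 K) => ‖((α₁ kv.2).map (· ^ (kv.1 + 1))).sum‖ ^ 2 /
        ((kv.1 + 1 : ℝ) * (kv.2.residueCard : ℝ) ^ ((kv.1 + 1 : ℝ) * s.re))) (hA hs)
  have hB' : Summable fun kv : ℕ × {v : HeightOneSpectrum (𝓞 K) // v ∉ S ∪ ↑S₂} =>
      ‖((β₂ kv.2.1).map (· ^ (kv.1 + 1))).sum‖ ^ 2 /
        ((kv.1 + 1 : ℝ) * (kv.2.1.residueCard : ℝ) ^ ((kv.1 + 1 : ℝ) * s.re)) :=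
    summable_prod_compl_union_of_summable
      (fun kv : ℕ × HeightOneSpectrum (𝓞 K) => ‖((β₂ kv.2).map (· ^ (kv.1 + 1))).sum‖ ^ 2 /
        ((kv.1 + 1 : ℝ) * (kv.2.residueCard : ℝ) ^ ((kv.1 + 1 : ℝ) * s.re))) (hB hs)
  have hmul := multipliable_inv_satakePairPolynomial hbα hbβ hs hA' hB'
  -- back to `S`
  refine multipliable_compl_of_union_finite
    (fun v : HeightOneSpectrum (𝓞 K) =>
      ((satakePairPolynomial (α v) (β v)).eval ((v.residueCard : ℂ) ^ (-s)))⁻¹) S₂.finite_toSet ?_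
  refine hmul.congr fun v => ?_
  have hv : v.1 ∉ S := fun h => v.2 (Or.inl h)
  simp only [hαα₁ v.1 hv, hββ₂ v.1 hv]

/-- **Jacquet–Shalika's Thm. (5.3) for pairs from the boundedness of the unramified Rankin–Selberg
torus sums at real points**, at `GL_n` and at `GL_m`: the named statement
`JacquetShalika1981_schurSelfSum_prod_bounded` of `JacquetShalikaSchurSelfSum` (the real-point content of
§4 + §2 of the source: bounded finite partial products `∏_{v ∈ F} ∑_λ |s_λ(x_v)|² q_v^{-|λ|σ}`, `σ > 1`)
gives (J) (`summable_normSq_trace_largeFinset_of_schurSelfSum_prod_bounded`: Cauchy's identity and the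
analysis of `ShintaniSelfSum`), hence the fact (`JacquetShalika1981_multipliable_partialPairL_of_largeFinset`).
This is the form in which the real-point Rankin–Selberg unfolding discharges the fact.
[cite: JacquetShalikaAJM1981, Thm. (5.3), §4 and §2] -/
theorem JacquetShalika1981_multipliable_partialPairL_of_schurSelfSum_prod_bounded
    (h : JacquetShalika1981_schurSelfSum_prod_bounded (μ := μ))
    (h' : JacquetShalika1981_schurSelfSum_prod_bounded (μ := μ')) :
    JacquetShalika1981_multipliable_partialPairL (n := n) (m := m) (K := K) (μ := μ) (μ' := μ') :=
  JacquetShalika1981_multipliable_partialPairL_of_largeFinset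
    (summable_normSq_trace_largeFinset_of_schurSelfSum_prod_bounded h)
    (summable_normSq_trace_largeFinset_of_schurSelfSum_prod_bounded h')

/-- **The mixed case**: bounded unramified torus sums at `GL_n` alone give the fact for pairs
`GL_n × GL_m` with `m ≤ 1`, the rank-`≤ 1` input being unconditional
(`summable_normSq_trace_satakePow_of_le_one` of `SatakeParameterUnitBound`, (J) from it by
`summable_normSq_trace_largeFinset_of_summable`). [cite: JacquetShalikaAJM1981, Thm. (5.3)] -/
theorem JacquetShalika1981_multipliable_partialPairL_of_schurSelfSum_prod_bounded_of_le_one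
    (h : JacquetShalika1981_schurSelfSum_prod_bounded (μ := μ)) (hm : m ≤ 1) :
    JacquetShalika1981_multipliable_partialPairL (n := n) (m := m) (K := K) (μ := μ) (μ' := μ') :=
  JacquetShalika1981_multipliable_partialPairL_of_largeFinset
    (summable_normSq_trace_largeFinset_of_schurSelfSum_prod_bounded h)
    (summable_normSq_trace_largeFinset_of_summable (summable_normSq_trace_satakePow_of_le_one hm))

end PairsLargeFinset

end Literature.NumberTheory.Automorphic
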